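import Summits.CriticalPhenomena.PercolationContinuityZ3.Theorems.PercNearOneGluingNoHeavyLowerTailAntitheticTopEar
import Summits.CriticalPhenomena.PercolationContinuityZ3.Theorems.PercNearOneGluingNoHeavyLowerTailAntitheticTopVertex
import HarnessLib

/-!
# `NoHeavyLowerTail` (stmt-CriticalPhenomena-4575) — antithetic cluster pairs: **THEOREM T-EAR AT A NEIGHBOUR OF THE SOURCE — an
# UNCONDITIONAL Δ2 family over an ARBITRARY core** (prim-hp-2 gen 69, HOME/MEMO-gen69.md §1)

Support file (`--supports stmt-CriticalPhenomena-4575`, hull-port prover `prim-hp-2`, gen 69).  No definitions, no named facts, no sorries;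
standard axioms.  Notation of …AntitheticTopEar / …AntitheticTopVertex.

THEOREM T-EAR (…AntitheticTopEar) derives CONJECTURE Δ2 at `x` for `K` + the cycle `Q – P – u₁ – … – y – x – Q` + the chord `sQ` from the
TOP hypothesis TOP_shift(K; P) of the core alone; `TopVertex.top_sum_nonneg_of_adj` (…AntitheticTopVertex) proves TOP_shift(K; P) on EVERY
graph in which `P` is a neighbour of the source (`P ∉ Y` forces `sP` red; block freezing).  Together:

**THEOREM T-EAR′** (`TopEar.chorded_ear_vertex_sum_nonneg_of_adj`).  Let `K` be ANY loop-free finite graph, `s` the source, `sP ∈ K` an edge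
at the source, `Q, x, u₁, …, u_a = y` fresh vertices (`a ≥ 1`).  Form `E = K + sQ + QP + (P – u₁ – … – y) + xy + xQ` — i.e. glue a triangle
`sPQ` onto the edge `sP` and an ear `P – u₁ – … – y – x – Q` of length ≥ 3 onto `PQ`.  Then for all monotone `F, G`
  `0 ≤ Σ_{ω : ¬(x ∈ X ω ∧ x ∈ Y ω)} (F(X ω) − F(Y ω))·(G(X ω) − G(Y ω))`
— the vertex antithetic inequality at `R = {x}` / CONJECTURE Δ2 at `x`, with NO hypothesis on `K`.  (Not a case of THEOREM CE: `K + sQ + QP`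
is a cone at `Q` only if the blue clusters of `P` in `K` stay inside `N(s)`; not a source-on-the-arm case: `s` is not on the handle.)
[cite: VandenbergHaggstromKahn2005, §1 p. 6 ("Harris' inequality"), §1 p. 3 (open cluster `C_s`)]
-/

noncomputable section

namespace Summit.CriticalPhenomena.PercolationContinuityZ3.Theorems

open Literature.Probability.Percolation
open scoped Classical

namespace Antithetic

namespace TopEar

variable {V : Type*} [Fintype V]

/-- **THEOREM T-EAR′ (any core, `P` a neighbour of the source).**  `K` loop-free avoiding `Q`, `sP ∈ K`, `s, P, Q` distinct; arm
`P = u 0, …, u a = y` fresh; `x` fresh joined to `y` and `Q`, `yQ ∉ (K + sQ + QP) ∪ arm`.  Then the vertex antithetic inequality at `R = {x}`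
holds for `E = ((K + QP + sQ) ∪ arm) + xQ + xy`, for all monotone `F, G` (core written `insert QP (insert sQ K)`). [this work] -/
theorem chorded_ear_vertex_sum_nonneg_of_adj {K : Set (Sym2 V)} {s P Q : V} {u : ℕ → V} {a : ℕ}
    (hnd : ∀ f ∈ K, ¬ f.IsDiag) (hQK : ∀ e ∈ K, Q ∉ e) (hsQ : s ≠ Q) (hPQ : P ≠ Q) (hsP : s ≠ P) (hsPK : s(s, P) ∈ K)
    (hu0 : u 0 = P) (hufresh : ∀ i, 0 < i → i ≤ a → ∀ f ∈ insert s(Q, P) (insert s(s, Q) K), u i ∈ f → f.IsDiag)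
    (huinj : ∀ i j, i ≤ a → j ≤ a → u i = u j → i = j) (hsu : ∀ i, 0 < i → i ≤ a → s ≠ u i) (hQu : ∀ i, 0 < i → i ≤ a → Q ≠ u i)
    {x : V} (hx : ∀ f ∈ insert s(Q, P) (insert s(s, Q) K) ∪ Cyc.edgeSet a u, x ∈ f → f.IsDiag) (hxs : x ≠ s) (hxy : x ≠ u a)
    (hxQ : x ≠ Q) (hyQ : u a ≠ Q) (hg : s(u a, Q) ∉ insert s(Q, P) (insert s(s, Q) K) ∪ Cyc.edgeSet a u)
    {F G : Set V → ℝ} (hF : Monotone F) (hG : Monotone G) :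
    -- (the core is written `insert QP (insert sQ K)` here; …AntitheticTopEar writes `insert sQ (insert QP K)` — same set)
    0 ≤ ∑ ω ∈ Finset.univ.filter (fun ω : Set (Sym2 V) =>
        ¬ ((openGraph (ω ∩ insert s(x, Q) (insert s(x, u a)
              (insert s(Q, P) (insert s(s, Q) K) ∪ Cyc.edgeSet a u)))).Reachable s x ∧
          (openGraph (ωᶜ ∩ insert s(x, Q) (insert s(x, u a)
              (insert s(Q, P) (insert s(s, Q) K) ∪ Cyc.edgeSet a u)))).Reachable s x)),
      (F (openCluster (ω ∩ insert s(x, Q) (insert s(x, u a) (insert s(Q, P) (insert s(s, Q) K) ∪ Cyc.edgeSet a u))) s) -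
          F (openCluster (ωᶜ ∩ insert s(x, Q) (insert s(x, u a) (insert s(Q, P) (insert s(s, Q) K) ∪ Cyc.edgeSet a u))) s)) *
        (G (openCluster (ω ∩ insert s(x, Q) (insert s(x, u a) (insert s(Q, P) (insert s(s, Q) K) ∪ Cyc.edgeSet a u))) s) -
          G (openCluster (ωᶜ ∩ insert s(x, Q) (insert s(x, u a) (insert s(Q, P) (insert s(s, Q) K) ∪ Cyc.edgeSet a u))) s)) :=
by
  have hE : insert s(Q, P) (insert s(s, Q) K) = insert s(s, Q) (insert s(Q, P) K) := Set.insert_comm _ _ _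
  rw [hE] at hufresh hx hg ⊢
  exact chorded_ear_vertex_sum_nonneg hnd hQK hsQ hPQ hsP
    (fun Fp Fm Gp Gm hFp hFm hF' hGp hGm hG' => TopVertex.top_sum_nonneg_of_adj K s P hsP hsPK Fp Fm Gp Gm hFp hFm hF' hGp hGm hG')
    hu0 hufresh huinj hsu hQu hx hxs hxy hxQ hyQ hg hF hG

end TopEar

end Antithetic

end Summit.CriticalPhenomena.PercolationContinuityZ3.Theorems
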